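import Summits.RiemannHypothesis.RiemannHypothesis.Theorems.Splittings.ScrewBridgeFozConsequences
import Summits.RiemannHypothesis.RiemannHypothesis.Theorems.WeilFormatCSchurStep
import HarnessLib

/-!
# Splittings — SCREW BRIDGE RIGIDITY, part 1/2: the bordered-matrix kernel lemma (zero-def raw form)

Cell rh-split (brief sha16 f79c5f09d8bcb036), seat rh-split-screw-bridge g4, gen-4 addendum §9 of
`run/shared/lean/pub/rh-split/cards/SPLIT-screw-bridge.md` (§6 of the seat's scratch); source bytes
`HOME/rh-split-screw-bridge/ScrewBridgeG4R.lean` sha16 3175454434f3e601 (16 theorems, zero defs), referee rh-split-ref g2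
replay + bytes PASS 2026-08-27T01:43:06Z; filed by rh-split-typer-2 g3 (lead 01:43:05Z) as a TWO-FILE split forced by the
400-line rule (this part = the seat's first five declarations, pure linear algebra, minus the Cauchy–Schwarz lemma
`dotProduct_sq_le_mul`, which the gate identified with the landed `WeilFormatC.dotProduct_sq_le_dotProduct_self_mul` and is cited; part 2 = `Splittings/ScrewBridgeRigidity.lean`),
namespace `…Splittings.ScrewBridgeRigidity` in both parts, every declaration byte-identical.

Content: `exists_neg_margin`, `form_snoc`, `mulVec_snoc_zero_apply` and the KEY LEMMA
`border_dotProduct_eq_zero_of_negIndex_le` — a real symmetric bordered matrix whose negative index does not exceed that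
of its leading block has its border column orthogonal to the kernel of the block (proof by a `(k+1)`-frame and
`SylvesterInertiaCertificate`).  RH-free linear algebra.

HONEST LABEL: SPLITTING SEARCH over kernel-typed RH-EQUIVALENCES; a splitting A ∧ B ⟹ RH is CONDITIONAL
bookkeeping unless A and B are both proved; nothing here bears on the truth of RH.
-/

set_option linter.dupNamespace false

noncomputable section

namespace Summit.RiemannHypothesis.RiemannHypothesis.Theorems.Splittings.ScrewBridgeRigidity

open Finset Matrix
open Literature.Analysis.Matrix Literature.Analysis.Matrix.KyFan
open Literature.Analysis.Matrix.EigenvalueCountOnSubspaces Literature.Analysis.Matrix.EigenvalueCount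
open Literature.NumberTheory.LFunctions
open Summit.RiemannHypothesis.RiemannHypothesis.Theses.RuelleBand
open Summit.RiemannHypothesis.RiemannHypothesis.Theorems.IntegerScrew
open Summit.RiemannHypothesis.RiemannHypothesis.Theorems.IntegerScrew.FozIndexBound
open Summit.RiemannHypothesis.RiemannHypothesis.Theorems.Splittings.BombieriFozNoDep
open Summit.RiemannHypothesis.RiemannHypothesis.Theorems.Splittings.ScrewBridgeRaw
open Summit.RiemannHypothesis.RiemannHypothesis.Theorems.Splittings.ScrewBridgeRawG3
open Summit.RiemannHypothesis.RiemannHypothesis.Theorems.Splittings.ScrewBridgeFozConsequences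

/-! ## §6 Rigidity of degeneracy under a frozen negative index -/

section Rigidity

-- `dotProduct_sq_le_mul` (Cauchy–Schwarz for `⬝ᵥ`) of the seat's scratch is the landed
-- `WeilFormatC.dotProduct_sq_le_dotProduct_self_mul` (Theorems/WeilFormatCSchurStep.lean); cited, not re-declared (gate dedup).

/-- A uniform margin below zero for the negative values of a finite family. [folklore] -/
theorem exists_neg_margin {ι : Type*} [Fintype ι] (f : ι → ℝ) :
    ∃ μ : ℝ, 0 < μ ∧ ∀ i, f i < 0 → f i < -μ := by
  classical
  by_cases h : (univ.filter fun i => f i < 0).Nonempty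
  · obtain ⟨i₀, hi₀, hmax⟩ := Finset.exists_max_image _ f h
    have hneg : f i₀ < 0 := (Finset.mem_filter.mp hi₀).2
    refine ⟨-f i₀ / 2, by linarith, fun i hi => ?_⟩
    have := hmax i (Finset.mem_filter.mpr ⟨Finset.mem_univ _, hi⟩)
    linarith
  · refine ⟨1, one_pos, fun i hi => ?_⟩
    exact absurd ⟨i, Finset.mem_filter.mpr ⟨Finset.mem_univ _, hi⟩⟩ h

/-- The form of a bordered symmetric matrix at `Fin.snoc y s`, through the leading block, the border and
the corner. [folklore] -/
theorem form_snoc {n : ℕ} {A : Matrix (Fin (n + 1)) (Fin (n + 1)) ℝ} (hA : A.IsHermitian)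
    (y : Fin n → ℝ) (s : ℝ) :
    Fin.snoc y s ⬝ᵥ A *ᵥ Fin.snoc y s =
      y ⬝ᵥ (A.submatrix Fin.castSucc Fin.castSucc) *ᵥ y +
        2 * s * ((fun j => A (Fin.last n) (Fin.castSucc j)) ⬝ᵥ y) + s * s * A (Fin.last n) (Fin.last n) := by
  have hsym : ∀ i j, A i j = A j i := fun i j => by
    simpa using (hA.apply i j).symm
  have e1 : Fin.snoc y s ⬝ᵥ A *ᵥ Fin.snoc y s =
      ∑ i : Fin (n + 1), ∑ j : Fin (n + 1),
        (Fin.snoc y s : Fin (n + 1) → ℝ) i * (A i j * (Fin.snoc y s : Fin (n + 1) → ℝ) j) := by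
    simp only [dotProduct, mulVec, Finset.mul_sum]
  have e4 : y ⬝ᵥ (A.submatrix Fin.castSucc Fin.castSucc) *ᵥ y =
      ∑ i : Fin n, ∑ j : Fin n, y i * (A (Fin.castSucc i) (Fin.castSucc j) * y j) := by
    simp only [dotProduct, mulVec, Finset.mul_sum, submatrix_apply]
  rw [e1, e4, Fin.sum_univ_castSucc]
  simp only [Fin.sum_univ_castSucc, Fin.snoc_castSucc, Fin.snoc_last, Finset.sum_add_distrib]
  have e2 : ∑ i : Fin n, y i * (A (Fin.castSucc i) (Fin.last n) * s) =
      s * ((fun j => A (Fin.last n) (Fin.castSucc j)) ⬝ᵥ y) := by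
    simp only [dotProduct, Finset.mul_sum]
    exact Finset.sum_congr rfl fun i _ => by rw [hsym]; ring
  have e3 : ∑ j : Fin n, s * (A (Fin.last n) (Fin.castSucc j) * y j) =
      s * ((fun j => A (Fin.last n) (Fin.castSucc j)) ⬝ᵥ y) := by
    simp only [dotProduct, Finset.mul_sum]
  rw [e2, e3]
  ring

/-- `(A (z, 0))_i = Σ_{j<n} A i j z_j`. [folklore] -/
theorem mulVec_snoc_zero_apply {n : ℕ} (A : Matrix (Fin (n + 1)) (Fin (n + 1)) ℝ) (z : Fin n → ℝ)
    (i : Fin (n + 1)) : (A *ᵥ Fin.snoc z 0) i = ∑ j : Fin n, A i (Fin.castSucc j) * z j := by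
  simp [mulVec, dotProduct, Fin.sum_univ_castSucc]

/-- **KEY LEMMA (null-space rigidity under a non-increasing negative index).**  Let `A` be real symmetric
of size `n+1` with leading block `B`.  If `A` has no more negative eigenvalues than `B`, then the border
column of `A` is orthogonal to `ker B` — so every null vector of `B` extends by `0` to a null vector of `A`.
(If `bᵀz ≠ 0` for some `z ∈ ker B`, the direction `(z, −t)` together with a negative eigen-frame of `B`
spans, for small `t > 0`, a negative definite subspace of dimension `n₋(B) + 1`.) [folklore] -/
theorem border_dotProduct_eq_zero_of_negIndex_le {n : ℕ} {A : Matrix (Fin (n + 1)) (Fin (n + 1)) ℝ}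
    (hA : A.IsHermitian) {B : Matrix (Fin n) (Fin n) ℝ} (hB : B.IsHermitian)
    (hAB : A.submatrix Fin.castSucc Fin.castSucc = B)
    (hidx : (univ.filter fun i => hA.eigenvalues i < 0).card ≤
      (univ.filter fun j => hB.eigenvalues j < 0).card)
    {z : Fin n → ℝ} (hz : B *ᵥ z = 0) :
    (fun j => A (Fin.last n) (Fin.castSucc j)) ⬝ᵥ z = 0 := by
  classical
  -- reduce to the case `0 < β`
  suffices key : ∀ z : Fin n → ℝ, B *ᵥ z = 0 →
      ¬ (0 < (fun j => A (Fin.last n) (Fin.castSucc j)) ⬝ᵥ z) by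
    by_contra hne
    rcases lt_or_gt_of_ne hne with hlt | hgt
    · refine key (-z) (by rw [mulVec_neg, hz, neg_zero]) ?_
      rw [dotProduct_neg]; linarith
    · exact key z hz hgt
  intro z hz hpos
  set b : Fin n → ℝ := fun j => A (Fin.last n) (Fin.castSucc j) with hbdef
  set β : ℝ := b ⬝ᵥ z with hβdef
  set γ : ℝ := A (Fin.last n) (Fin.last n) with hγdef
  set k := (univ.filter fun j => hB.eigenvalues j < 0).card with hkdef
  obtain ⟨μ, hμ, hμlt⟩ := exists_neg_margin hB.eigenvalues
  have hcard : Fintype.card (Fin k) ≤ (univ.filter fun j => hB.eigenvalues j < -μ).card := by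
    rw [Fintype.card_fin]
    exact Finset.card_le_card fun j hj => by
      rw [Finset.mem_filter] at hj ⊢
      exact ⟨hj.1, hμlt j hj.2⟩
  obtain ⟨v, hv⟩ := exists_frame_of_card_le hB (κ := Fin k) hcard
  have hbb : 0 ≤ b ⬝ᵥ b := by
    unfold dotProduct; exact Finset.sum_nonneg fun i _ => mul_self_nonneg _
  -- the small parameter `t`
  set D : ℝ := 4 * (|γ| + 1) * (μ + 1) * (b ⬝ᵥ b + 1) with hDdef
  have hD : 0 < D := by positivity
  set t : ℝ := β * μ / D with htdef
  have ht : 0 < t := div_pos (mul_pos hpos hμ) hD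
  have hprod : 1 ≤ (|γ| + 1) * (μ + 1) := by nlinarith [abs_nonneg γ, hμ.le]
  have ht1 : t * |γ| ≤ β / 4 := by
    have h1 : μ * |γ| ≤ (|γ| + 1) * (μ + 1) * (b ⬝ᵥ b + 1) := by
      have : μ * |γ| ≤ (|γ| + 1) * (μ + 1) := by nlinarith [abs_nonneg γ, hμ.le]
      exact this.trans (le_mul_of_one_le_right (by positivity) (by linarith))
    have e : t * |γ| = β * ((μ * |γ|) / D) := by rw [htdef]; ring
    rw [e]
    have h2 : (μ * |γ|) / D ≤ 1 / 4 := by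
      rw [div_le_iff₀ hD]
      have hD' : D = 4 * (|γ| + 1) * (μ + 1) * (b ⬝ᵥ b + 1) := hDdef
      nlinarith [h1, hD']
    nlinarith [h2, hpos.le]
  have ht2 : 2 * t * (b ⬝ᵥ b) ≤ μ * β / 2 := by
    have h1 : b ⬝ᵥ b ≤ (|γ| + 1) * (μ + 1) * (b ⬝ᵥ b + 1) := by nlinarith [hprod, hbb]
    have e : 2 * t * (b ⬝ᵥ b) = (μ * β) * (2 * (b ⬝ᵥ b) / D) := by rw [htdef]; ring
    rw [e]
    have h2 : 2 * (b ⬝ᵥ b) / D ≤ 1 / 2 := by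
      rw [div_le_iff₀ hD]
      have hD' : D = 4 * (|γ| + 1) * (μ + 1) * (b ⬝ᵥ b + 1) := hDdef
      nlinarith [h1, hD']
    have h3 : 0 ≤ μ * β := (mul_pos hμ hpos).le
    nlinarith [h2, h3]
  -- the `(k+1)`-frame for `A`
  let V : Matrix (Fin (n + 1)) (Option (Fin k)) ℝ :=
    Matrix.of fun i o => Option.elim o ((Fin.snoc z (-t) : Fin (n + 1) → ℝ) i)
      (fun b' => (Fin.snoc (v b') 0 : Fin (n + 1) → ℝ) i)
  have hVc : ∀ c : Option (Fin k) → ℝ,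
      V *ᵥ c = Fin.snoc (∑ b', c (some b') • v b' + c none • z) (-(c none * t)) := by
    intro c
    funext i
    simp only [V, mulVec, dotProduct, Matrix.of_apply, Fintype.sum_option, Option.elim_none,
      Option.elim_some]
    refine Fin.lastCases ?_ (fun j => ?_) i
    · simp only [Fin.snoc_last]
      simp
      ring
    · simp only [Fin.snoc_castSucc, Pi.add_apply, Pi.smul_apply, Finset.sum_apply, smul_eq_mul]
      rw [add_comm]
      congr 1
      · exact Finset.sum_congr rfl fun b' _ => mul_comm _ _
      · exact mul_comm _ _
  have hneg : ∀ c : Option (Fin k) → ℝ, c ≠ 0 →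
      (V *ᵥ c) ⬝ᵥ A *ᵥ (V *ᵥ c) < 0 * ((V *ᵥ c) ⬝ᵥ (V *ᵥ c)) := by
    intro c hc
    rw [zero_mul, hVc c, form_snoc hA, hAB]
    set x : Fin n → ℝ := ∑ b', c (some b') • v b' with hxdef
    set c₀ : ℝ := c none with hc₀def
    have e1 : (x + c₀ • z) ⬝ᵥ B *ᵥ (x + c₀ • z) = x ⬝ᵥ B *ᵥ x := by
      have hzBx : z ⬝ᵥ B *ᵥ x = 0 := by
        rw [dotProduct_mulVec, ← mulVec_transpose, transpose_eq hB, hz, zero_dotProduct]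
      rw [mulVec_add, mulVec_smul, hz, smul_zero, add_zero, add_dotProduct, smul_dotProduct, hzBx,
        smul_zero, add_zero]
    have e2 : b ⬝ᵥ (x + c₀ • z) = b ⬝ᵥ x + c₀ * β := by
      rw [dotProduct_add, dotProduct_smul, smul_eq_mul]
    rw [e1, e2]
    have hX : 0 ≤ x ⬝ᵥ x := by
      unfold dotProduct; exact Finset.sum_nonneg fun i _ => mul_self_nonneg _
    have F1 : x ⬝ᵥ B *ᵥ x ≤ -μ * (x ⬝ᵥ x) := by
      by_cases hc' : (fun b' => c (some b')) = 0
      · have hx0 : x = 0 := by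
          rw [hxdef]
          exact Finset.sum_eq_zero fun b' _ => by
            rw [show c (some b') = 0 from congr_fun hc' b', zero_smul]
        rw [hx0]; simp
      · have := hv (fun b' => c (some b')) hc'
        exact this.le
    have F2 : (b ⬝ᵥ x) ^ 2 ≤ (b ⬝ᵥ b) * (x ⬝ᵥ x) := Summit.RiemannHypothesis.RiemannHypothesis.Theorems.WeilFormatC.dotProduct_sq_le_dotProduct_self_mul b x
    have F3 : -(2 * c₀ * t * (b ⬝ᵥ x)) ≤ t * (2 / β) * (b ⬝ᵥ x) ^ 2 + t * (β / 2) * c₀ ^ 2 := by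
      have hsq : 0 ≤ t * (β / 2) * (c₀ + 2 / β * (b ⬝ᵥ x)) ^ 2 := by positivity
      have hexp : t * (β / 2) * (c₀ + 2 / β * (b ⬝ᵥ x)) ^ 2 =
          t * (β / 2) * c₀ ^ 2 + 2 * c₀ * t * (b ⬝ᵥ x) + t * (2 / β) * (b ⬝ᵥ x) ^ 2 := by
        field_simp
        ring
      linarith [hsq, hexp]
    have F4 : t * (2 / β) * ((b ⬝ᵥ b) * (x ⬝ᵥ x)) ≤ μ / 2 * (x ⬝ᵥ x) := by
      have h1 : t * (2 / β) * (b ⬝ᵥ b) ≤ μ / 2 := by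
        have e : t * (2 / β) * (b ⬝ᵥ b) = (2 * t * (b ⬝ᵥ b)) / β := by
          field_simp
        rw [e, div_le_iff₀ hpos]
        linarith [ht2]
      calc t * (2 / β) * ((b ⬝ᵥ b) * (x ⬝ᵥ x)) = (t * (2 / β) * (b ⬝ᵥ b)) * (x ⬝ᵥ x) := by ring
        _ ≤ μ / 2 * (x ⬝ᵥ x) := mul_le_mul_of_nonneg_right h1 hX
    have F5 : (-(c₀ * t)) * (-(c₀ * t)) * γ ≤ c₀ ^ 2 * t * (β / 4) := by
      have h1 : t * γ ≤ β / 4 :=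
        (mul_le_mul_of_nonneg_left (le_abs_self γ) ht.le).trans ht1
      calc (-(c₀ * t)) * (-(c₀ * t)) * γ = c₀ ^ 2 * t * (t * γ) := by ring
        _ ≤ c₀ ^ 2 * t * (β / 4) := mul_le_mul_of_nonneg_left h1 (by positivity)
    have F2' : t * (2 / β) * (b ⬝ᵥ x) ^ 2 ≤ t * (2 / β) * ((b ⬝ᵥ b) * (x ⬝ᵥ x)) :=
      mul_le_mul_of_nonneg_left F2 (by positivity)
    have hmain : x ⬝ᵥ B *ᵥ x + 2 * (-(c₀ * t)) * (b ⬝ᵥ x + c₀ * β) +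
          (-(c₀ * t)) * (-(c₀ * t)) * γ
        ≤ -(μ / 2) * (x ⬝ᵥ x) - (5 / 4) * t * β * c₀ ^ 2 := by
      nlinarith [F1, F2', F3, F4, F5]
    by_cases h0 : x ⬝ᵥ x = 0 ∧ c₀ = 0
    · exfalso
      apply hc
      obtain ⟨hX0, hc0⟩ := h0
      have hx0 : x = 0 := dotProduct_self_eq_zero.mp hX0
      have hc' : (fun b' => c (some b')) = 0 := by
        by_contra hne
        have h := hv (fun b' => c (some b')) hne
        beta_reduce at h
        rw [← hxdef, hx0] at h
        simp at h
      funext o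
      cases o with
      | none => exact hc0
      | some b' => exact congr_fun hc' b'
    · have hstrict : 0 < μ / 2 * (x ⬝ᵥ x) + (5 / 4) * t * β * c₀ ^ 2 := by
        rcases not_and_or.mp h0 with hX0 | hc0
        · have hXpos : 0 < x ⬝ᵥ x := lt_of_le_of_ne hX (Ne.symm hX0)
          have : 0 < μ / 2 * (x ⬝ᵥ x) := by positivity
          have : 0 ≤ (5 / 4) * t * β * c₀ ^ 2 := by positivity
          linarith
        · have : 0 < c₀ ^ 2 := by positivity
          have : 0 < (5 / 4) * t * β * c₀ ^ 2 := by positivity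
          have : 0 ≤ μ / 2 * (x ⬝ᵥ x) := by positivity
          linarith
      linarith [hmain, hstrict]
  have hle := card_le_card_eigenvalues_lt hA V (θ := 0) hneg
  rw [Fintype.card_option, Fintype.card_fin] at hle
  omega

end Rigidity

end Summit.RiemannHypothesis.RiemannHypothesis.Theorems.Splittings.ScrewBridgeRigidity
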